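import Literature.Probability.Percolation.AnchoredProfileVanishing
import Literature.Probability.Percolation.HalfSpaceProofs
import HarnessLib

/-!
# Boundary-to-deep connections inside a box are rare where the half-space does not percolate

Topic `Literature/Probability/Percolation`.  The quantitative content, INSIDE FINITE BOXES, of
"no percolation in the half-space" (Barsky–Grimmett–Newman 1991; Grimmett 1999, Thm. (7.35)), in
the form isolated by Cerf–Dembin (2020, §2, (eq1)) for the centre of the box and extended here to
every deep site:

* `measure_openConnVia_box_le_halfSpaceReach` — for a site `w` of the inner vertex boundary of
  `Λ(n) = [-n,n]^d` and a site `x ∈ Λ(n-t)` (depth `≥ t` below every face),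
  `P_p(w ↔ x inside Λ(n)) ≤ P_p(A_t)`, `A_t = {0 ↔ height ≥ t inside ℍ}`
  (`CerfDembinVanishing.halfSpaceReach`): the lattice symmetry `y ↦ σ(y - w)` of Cerf–Dembin's
  (eq1) maps `w` to `0`, the box into `ℍ` and `x` to a site of height `≥ t`.
* `sum_gatewayPairs_le` — summing, the expected number of GATEWAY PAIRS
  `#{(w, x) ∈ ∂ⁱⁿΛ(n) × Λ(n-t) : w ↔ x inside Λ(n)}` is at most `|∂ⁱⁿΛ(n)| · |Λ(n-t)| · P_p(A_t)`.
* `gatewayPairs_small_of_theta_halfSpace` — if `θ_ℍ(p) = 0` then `P_p(A_t) → 0`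
  (`CerfDembinVanishing.tendsto_measure_halfSpaceReach`), so for every `ε > 0` and all large `t`,
  uniformly in `n ≥ t`, the gateway-pair count is `≤ ε |∂ⁱⁿΛ(n)| |Λ(n-t)|`: a uniformly chosen
  boundary site and a uniformly chosen `t`-deep site are joined inside the box with probability
  `≤ ε`.
* `gatewayPairs_small_criticalProbI_three` — the unconditional case `d = 3`, `p = p_c(ℤ³)`
  (the tree's proved `BarskyGrimmettNewman1991_Z3_holds`), also in the `openConnIn` vocabulary
  (`gatewayPairs_small_criticalProbI_three'`).

Why it is recorded (crux `FreeBoxSparse`, stmt-CriticalPhenomena-4445, lead analysis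
`Cruxes/FreeBoxSparse/ResidualAnalysisLeadC1.md` §3(a)): every free piece of `Λ(n)` that meets
the infinite cluster touches `∂ⁱⁿΛ(n)`; a `δ`-dense such piece with `≥ c n^{d-1}` boundary sites
would carry `≥ c n^{d-1} · (δ/2)|Λ(n)|` gateway pairs, which this bound and Markov's inequality
forbid with probability `→ 1` — so at `p_c` dense pieces of the infinite cluster, if any, are fed
through `o(n^{d-1})` gateways ("bottlenecked"), cf. Cerf–Dembin's vanishing anchored
isoperimetric profile.  The bound prices MANY gateways, not one.

## References
* R. Cerf, B. Dembin, *Vanishing of the anchored isoperimetric profile in bond percolation at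
  `p_c`*, Electron. Commun. Probab. 25 (2020), §2, (eq1) (the symmetry step, for the centre).
* D. J. Barsky, G. R. Grimmett, C. M. Newman, PTRF 90 (1991); G. Grimmett, *Percolation*, 2nd ed.
  (1999), Thm. (7.35).
-/

noncomputable section

namespace Literature.Probability.Percolation

open _root_.MeasureTheory _root_.Filter LatticeModels CerfDembinVanishing
open scoped _root_.ENNReal _root_.Topology

namespace BoxGateway

variable {d : ℕ}

/-- **`P_p(w ↔ x inside Λ(n)) ≤ P_p(A_t)` for `w ∈ ∂ⁱⁿΛ(n)` and `x ∈ Λ(n - t)`** (Cerf–Dembin §2,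
(eq1), with the centre `0` replaced by any `t`-deep site `x`): if `w_i = ∓n`, the lattice
automorphism `y ↦ σ(y - w)` (`σ` the signed coordinate permutation exchanging the axes `i` and `0`,
with sign `±`) maps `w` to `0`, the box `Λ(n)` into `ℍ`, and `x` to a site of height
`n ± x_i ≥ n - (n - t) = t`; it preserves `P_p` (`bondPercolation_map_relabel_iso`) and carries
constrained clusters to constrained clusters (`openClusterIn_relabel`).
[cite: CerfDembin2020, §2 ((eq1), symmetry of the lattice)] -/
theorem measure_openConnVia_box_le_halfSpaceReach [NeZero d] (p : unitInterval) {n t : ℕ}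
    {w x : Site d} (hw : w ∈ innerBoundary (zdGraph d) (box d n)) (hx : x ∈ box d (n - t))
    (htn : t ≤ n) :
    bondPercolation (zdGraph d) p (openConnVia (withinGraph (zdGraph d) ↑(box d n)) w x) ≤
      bondPercolation (zdGraph d) p (halfSpaceReach d t) := by
  obtain ⟨i, hi⟩ := exists_eq_of_mem_innerBoundary_box hw
  -- the sign of the reflection
  obtain ⟨s, hs0, hsbox, hsx⟩ : ∃ s : ℤˣ, (s : ℤ) * (0 - w i) = n ∧
      (∀ y ∈ box d n, 0 ≤ (s : ℤ) * (y i - w i)) ∧ (t : ℤ) ≤ (s : ℤ) * (x i - w i) := by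
    have hxi := mem_box.1 hx i
    have hcast : ((n - t : ℕ) : ℤ) = (n : ℤ) - t := by push_cast [Nat.cast_sub htn]; ring
    rw [hcast] at hxi
    by_cases hwi : w i = (n : ℤ)
    · refine ⟨-1, by rw [hwi]; simp, fun y hy => ?_, ?_⟩
      · have := (mem_box.1 hy i).2
        rw [hwi]; push_cast; linarith
      · rw [hwi]; push_cast; linarith [hxi.2]
    · have hwi' : w i = -(n : ℤ) := hi.resolve_left hwi
      refine ⟨1, by rw [hwi']; simp, fun y hy => ?_, ?_⟩
      · have := (mem_box.1 hy i).1
        rw [hwi']; push_cast; linarith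
      · rw [hwi']; push_cast; linarith [hxi.1]
  -- the automorphism `ψ y = σ (y - w)`
  set π : Equiv.Perm (Fin d) := Equiv.swap i 0 with hπ
  set ψ : zdGraph d ≃g zdGraph d := (zdShiftIso (-w)).trans (zdSignedPermIso π fun _ => s) with hψ
  set e : Site d ≃ Site d := ψ.toEquiv with he
  have he_apply : ∀ y, e y = Site.signedPerm π (fun _ => s) (y + -w) := fun y => rfl
  have he0 : ∀ y, e y 0 = (s : ℤ) * (y i - w i) := fun y => by
    rw [he_apply, Site.signedPerm_apply, hπ, Equiv.symm_swap, Equiv.swap_apply_right]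
    simp [sub_eq_add_neg]
  have hew : e w = 0 := by rw [he_apply, add_neg_cancel, Site.signedPerm_zero]
  have hadj : ∀ u v, (zdGraph d).Adj (e u) (e v) ↔ (zdGraph d).Adj u v := fun u v => ψ.map_rel_iff'
  have hK : ∀ u v, (withinGraph (zdGraph d) (e '' ↑(box d n))).Adj (e u) (e v) ↔
      (withinGraph (zdGraph d) ↑(box d n)).Adj u v := fun u v => by
    simp only [withinGraph_adj, e.injective.mem_set_image, hadj u v]
  have himg : e '' (↑(box d n) : Set (Site d)) ⊆ halfSpace d := by
    rintro _ ⟨y, hy, rfl⟩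
    change 0 ≤ e y 0
    rw [he0]
    exact hsbox y hy
  -- the inclusion of events
  have hsub : openConnVia (withinGraph (zdGraph d) ↑(box d n)) w x ⊆
      BondConfig.relabel (sym2Equiv e) ⁻¹' halfSpaceReach d t := by
    intro ω hω
    have hxω : x ∈ openClusterIn (withinGraph (zdGraph d) ↑(box d n)) ω w := hω
    have hrel := openClusterIn_relabel e hK ω w
    have hmem : e x ∈ openClusterIn (withinGraph (zdGraph d) (e '' ↑(box d n)))
        (BondConfig.relabel (sym2Equiv e) ω) 0 := by
      have h := Set.mem_image_of_mem e hxω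
      rwa [← hrel, hew] at h
    refine ⟨e x, openClusterIn_mono_graph (withinGraph_mono _ himg) _ 0 hmem, ?_⟩
    rw [he0]
    exact hsx
  calc bondPercolation (zdGraph d) p (openConnVia (withinGraph (zdGraph d) ↑(box d n)) w x)
      ≤ bondPercolation (zdGraph d) p (BondConfig.relabel (sym2Equiv e) ⁻¹' halfSpaceReach d t) :=
        measure_mono hsub
    _ = (bondPercolation (zdGraph d) p).map (BondConfig.relabel (sym2Equiv e)) (halfSpaceReach d t) :=
        (MeasurableEquiv.map_apply _ _).symm
    _ = bondPercolation (zdGraph d) p (halfSpaceReach d t) := by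
        rw [he, bondPercolation_map_relabel_iso ψ p]

/-- Real-valued form of `measure_openConnVia_box_le_halfSpaceReach`. [folklore] -/
theorem real_openConnVia_box_le_halfSpaceReach [NeZero d] (p : unitInterval) {n t : ℕ}
    {w x : Site d} (hw : w ∈ innerBoundary (zdGraph d) (box d n)) (hx : x ∈ box d (n - t))
    (htn : t ≤ n) :
    (bondPercolation (zdGraph d) p).real (openConnVia (withinGraph (zdGraph d) ↑(box d n)) w x) ≤
      (bondPercolation (zdGraph d) p).real (halfSpaceReach d t) := by
  simp only [measureReal_def]
  exact ENNReal.toReal_mono (measure_ne_top _ _) (measure_openConnVia_box_le_halfSpaceReach p hw hx htn)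

/-- **Expected number of gateway pairs.** `E_p #{(w,x) ∈ ∂ⁱⁿΛ(n) × Λ(n-t) : w ↔ x inside Λ(n)}
≤ |∂ⁱⁿΛ(n)| · |Λ(n-t)| · P_p(A_t)` (linearity and the previous lemma). [folklore] -/
theorem sum_gatewayPairs_le [NeZero d] (p : unitInterval) {n t : ℕ} (htn : t ≤ n) :
    ∑ w ∈ innerBoundary (zdGraph d) (box d n), ∑ x ∈ box d (n - t),
        (bondPercolation (zdGraph d) p).real (openConnVia (withinGraph (zdGraph d) ↑(box d n)) w x) ≤
      (innerBoundary (zdGraph d) (box d n)).card * (box d (n - t)).card *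
        (bondPercolation (zdGraph d) p).real (halfSpaceReach d t) := by
  calc ∑ w ∈ innerBoundary (zdGraph d) (box d n), ∑ x ∈ box d (n - t),
        (bondPercolation (zdGraph d) p).real (openConnVia (withinGraph (zdGraph d) ↑(box d n)) w x)
      ≤ ∑ _w ∈ innerBoundary (zdGraph d) (box d n), ∑ _x ∈ box d (n - t),
          (bondPercolation (zdGraph d) p).real (halfSpaceReach d t) :=
        Finset.sum_le_sum fun w hw => Finset.sum_le_sum fun x hx =>
          real_openConnVia_box_le_halfSpaceReach p hw hx htn
    _ = (innerBoundary (zdGraph d) (box d n)).card * (box d (n - t)).card *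
          (bondPercolation (zdGraph d) p).real (halfSpaceReach d t) := by
        rw [Finset.sum_const, nsmul_eq_mul, Finset.sum_const, nsmul_eq_mul]; ring

/-- **Gateway pairs are rare where the half-space does not percolate.** If `θ_ℍ(p) = 0` then for
every `ε > 0` there is `T` such that for all `t ≥ T` and all `n ≥ t` the expected number of gateway
pairs is `≤ ε · |∂ⁱⁿΛ(n)| · |Λ(n-t)|` (uniformly in `n`): a uniform boundary site and a uniform
`t`-deep site are joined inside the box with probability `≤ ε`.  The input `θ_ℍ(p) = 0` holds at
`p = p_c(ℤ^d)` (Barsky–Grimmett–Newman; tree: `BarskyGrimmettNewman1991`, proved for `d = 2, 3`).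
[folklore] -/
theorem gatewayPairs_small_of_theta_halfSpace [NeZero d] (p : unitInterval)
    (hθ : theta (halfSpaceGraph d) (halfSpaceOrigin d) p = 0) {ε : ℝ} (hε : 0 < ε) :
    ∃ T : ℕ, ∀ t, T ≤ t → ∀ n, t ≤ n →
      ∑ w ∈ innerBoundary (zdGraph d) (box d n), ∑ x ∈ box d (n - t),
          (bondPercolation (zdGraph d) p).real (openConnVia (withinGraph (zdGraph d) ↑(box d n)) w x) ≤
        ε * ((innerBoundary (zdGraph d) (box d n)).card * (box d (n - t)).card) := by
  have hlim : Tendsto (fun t => (bondPercolation (zdGraph d) p).real (halfSpaceReach d t)) atTop (𝓝 0) := by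
    have h' : Tendsto (fun t => ((bondPercolation (zdGraph d) p) (halfSpaceReach d t)).toReal) atTop
        (𝓝 (0 : ℝ≥0∞).toReal) :=
      (ENNReal.tendsto_toReal ENNReal.zero_ne_top).comp (tendsto_measure_halfSpaceReach p hθ)
    rw [ENNReal.toReal_zero] at h'
    simpa only [measureReal_def] using h'
  obtain ⟨T, hT⟩ := (Metric.tendsto_atTop.1 hlim) ε hε
  refine ⟨T, fun t ht n htn => ?_⟩
  have hsmall : (bondPercolation (zdGraph d) p).real (halfSpaceReach d t) ≤ ε := by
    have := hT t ht
    rw [Real.dist_eq, sub_zero, abs_of_nonneg measureReal_nonneg] at this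
    exact this.le
  calc ∑ w ∈ innerBoundary (zdGraph d) (box d n), ∑ x ∈ box d (n - t),
        (bondPercolation (zdGraph d) p).real (openConnVia (withinGraph (zdGraph d) ↑(box d n)) w x)
      ≤ (innerBoundary (zdGraph d) (box d n)).card * (box d (n - t)).card *
          (bondPercolation (zdGraph d) p).real (halfSpaceReach d t) := sum_gatewayPairs_le p htn
    _ ≤ (innerBoundary (zdGraph d) (box d n)).card * (box d (n - t)).card * ε := by gcongr
    _ = ε * ((innerBoundary (zdGraph d) (box d n)).card * (box d (n - t)).card) := by ring

/-- **On `ℤ³` at `p_c` (unconditional).** For every `ε > 0` there is `T` such that for all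
`t ≥ T` and `n ≥ t`:
`Σ_{w ∈ ∂ⁱⁿΛ(n)} Σ_{x ∈ Λ(n-t)} P_{p_c}(w ↔ x inside Λ(n)) ≤ ε |∂ⁱⁿΛ(n)| |Λ(n-t)|`
(`θ_ℍ(p_c(ℤ³)) = 0` is the tree's proved `BarskyGrimmettNewman1991_Z3_holds`). [folklore] -/
theorem gatewayPairs_small_criticalProbI_three {ε : ℝ} (hε : 0 < ε) :
    ∃ T : ℕ, ∀ t, T ≤ t → ∀ n, t ≤ n →
      ∑ w ∈ innerBoundary (zdGraph 3) (box 3 n), ∑ x ∈ box 3 (n - t),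
          (bondPercolation (zdGraph 3) (criticalProbI 3)).real
            (openConnVia (withinGraph (zdGraph 3) ↑(box 3 n)) w x) ≤
        ε * ((innerBoundary (zdGraph 3) (box 3 n)).card * (box 3 (n - t)).card) :=
  gatewayPairs_small_of_theta_halfSpace (d := 3) (criticalProbI 3) BarskyGrimmettNewman1991_Z3_holds hε

/-- The same on `ℤ³` at `p_c` in the `openConnIn` vocabulary of `Percolation.lean`
(`{w ↔ x in Λ(n)}` via the induced open graph; the two events agree `P_p`-a.s.,
`openConnIn_ae_eq_openConnVia`). [folklore] -/
theorem gatewayPairs_small_criticalProbI_three' {ε : ℝ} (hε : 0 < ε) :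
    ∃ T : ℕ, ∀ t, T ≤ t → ∀ n, t ≤ n →
      ∑ w ∈ innerBoundary (zdGraph 3) (box 3 n), ∑ x ∈ box 3 (n - t),
          (bondPercolation (zdGraph 3) (criticalProbI 3)).real (openConnIn ↑(box 3 n) w x) ≤
        ε * ((innerBoundary (zdGraph 3) (box 3 n)).card * (box 3 (n - t)).card) := by
  obtain ⟨T, hT⟩ := gatewayPairs_small_criticalProbI_three hε
  refine ⟨T, fun t ht n htn => ?_⟩
  have heq : ∀ w ∈ innerBoundary (zdGraph 3) (box 3 n), ∀ x ∈ box 3 (n - t),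
      (bondPercolation (zdGraph 3) (criticalProbI 3)).real (openConnIn ↑(box 3 n) w x) =
        (bondPercolation (zdGraph 3) (criticalProbI 3)).real
          (openConnVia (withinGraph (zdGraph 3) ↑(box 3 n)) w x) := by
    intro w hw x _
    have hwbox : w ∈ (↑(box 3 n) : Set (Site 3)) :=
      Finset.mem_coe.2 (mem_innerBoundary_iff.1 hw).1
    exact measureReal_congr (openConnIn_ae_eq_openConnVia (G := zdGraph 3) (criticalProbI 3) hwbox x)
  calc ∑ w ∈ innerBoundary (zdGraph 3) (box 3 n), ∑ x ∈ box 3 (n - t),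
        (bondPercolation (zdGraph 3) (criticalProbI 3)).real (openConnIn ↑(box 3 n) w x)
      = ∑ w ∈ innerBoundary (zdGraph 3) (box 3 n), ∑ x ∈ box 3 (n - t),
          (bondPercolation (zdGraph 3) (criticalProbI 3)).real
            (openConnVia (withinGraph (zdGraph 3) ↑(box 3 n)) w x) :=
        Finset.sum_congr rfl fun w hw => Finset.sum_congr rfl fun x hx => heq w hw x hx
    _ ≤ _ := hT t ht n htn

end BoxGateway

end Literature.Probability.Percolation

end
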